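import Summits.HodgeConjecture.FermatCycles.ConditionQFourfoldSearch
import Summits.HodgeConjecture.FermatCycles.ConditionQFourfoldSeventyEightTable
import HarnessLib

/-!
# Shioda's stable-generation condition `(Q⁴ₘ)` at `m = 78` — kernel certificate (part A of 6)

HONEST FRAMING: explicit algebraic cycles for specific Hodge classes on Fermat/Delsarte varieties;
residual open instances listed; no claim on general Hodge.

Topic path `Summits/HodgeConjecture/FermatCycles/` of cell `pub-hfermat` (new work, not literature: a computer determination of the cell —
`pub-hfermat-enum/P4-TABLE.md` §(Q⁴ₘ), two implementations — certified by the Lean kernel). Framework: `ConditionQFourfold.lean`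
(certificate Booleans, searches `checkQU`/`checkQN`) and `ConditionQFourfoldSearch.lean` (`conditionQ_four_of_normalized`).

THE STATEMENT. Shioda, Math. Ann. 245 (1979) §4 p. 183: `(Qⁿₘ)` — every element of `Mₘ(y)`, `3 ≤ y ≤ n/2 + 1`, is `ξ₁ − ξ₂` with
`ξ₁, ξ₂ ∈ M'ₘ = ⟨Mₘ(1), Mₘ(2), Mₘ(3)^sd⟩` (pairs, Hodge classes of the Fermat surface, semi-decomposable sextuples); by his Claim
(p. 183, Lemmas 2–3) `(Qⁿₘ)` may replace `(Pⁿₘ)` in Theorem III (`⇒` the Hodge conjecture for `Xⁿₘ`); p. 184: "we do not know any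
value of `m` which satisfies `(Qₘ)` but not `(Pₘ)`". Tree: `Literature.AlgebraicGeometry.Shioda1979.ConditionQ m n`, `MPrime`,
`forall_of_conditionQ` (the Claim's arithmetic spine), `ConditionP` (Math. Ann. form of `(P)`), `FermatCharacter.ShiodaConditionUpTo`
(Proc. Japan Acad. form, with the semi-decomposable alternative).

WHAT IS PROVED HERE (level `m = 78`, part A).
* part A of 6: the kernel searches `checkQU 78 T 1 15`, `checkQU 78 T 16 15` (136312 tuples);

NUMBERS (this seat's search `code/lit/q4/q4norm.py` = implementation 2; implementation 1 = ENUM `code/enum/q4table.py`,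
`data/shioda_Q4_m3-100.json`): case U visits 151754 sorted tuples and case N 391422; 6617 of them are Hodge sextuples; all but 156 carry a
`(P)`-witness (case N pair 144, case N quasi 76, case N pair 4680, case N quasi 180, case N semi 50, case U pair 1176, case U quasi 137, case U semi 18); the other 156 — `(1, 6, 12, 64, 75, 76)` (case U); `(1, 6, 42, 45, 64, 76)` (case U); `(1, 7, 44, 49, 59, 74)` (case U); `(1, 7, 44, 53, 62, 67)` (case U); `(1, 7, 53, 54, 59, 60)` (case U); `(1, 9, 20, 56, 73, 75)` (case U); `(1, 9, 42, 49, 61, 72)` (case U); `(1, 10, 41, 53, 59, 70)` (case U); `(1, 10, 41, 56, 62, 64)` (case U); `(1, 10, 45, 53, 62, 63)` (case U); `(1, 11, 40, 54, 56, 72)` (case U); `(1, 12, 21, 60, 64, 76)` (case U); `(1, 12, 28, 54, 64, 75)` (case U); `(1, 12, 32, 42, 71, 76)` (case U); `(1, 12, 32, 42, 73, 74)` (case U); `(1, 12, 42, 50, 53, 76)` (case U); `(1, 12, 42, 53, 54, 72)` (case U); `(1, 12, 43, 49, 54, 75)` (case U); `(1, 12, 43, 54, 55, 69)` (case U); `(1,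 12, 43, 55, 60, 63)` (case U); `(1, 14, 40, 53, 54, 72)` (case U); `(1, 18, 30, 49, 61, 75)` (case U); `(1, 20, 21, 45, 73, 74)` (case U); `(1, 20, 31, 45, 63, 74)` (case U); `(1, 20, 31, 54, 56, 72)` (case U); `(1, 20, 41, 43, 62, 67)` (case U); `(1, 20, 43, 45, 62, 63)` (case U); `(1, 21, 30, 49, 61, 72)` (case U); `(1, 21, 44, 45, 49, 74)` (case U); `(1, 21, 44, 45, 53, 70)` (case U); `(1, 21, 45, 53, 54, 60)` (case U); `(1, 24, 27, 42, 64, 76)` (case U); `(1, 27, 28, 40, 66, 72)` (case U); `(1, 27, 28, 42, 64, 72)` (case U); `(1, 27, 31, 32, 69, 74)` (case U); `(1, 27, 42, 43, 49, 72)` (case U); `(1, 27, 43, 48, 55, 60)` (case U); `(1, 28, 30, 40, 63, 72)` (case U); `(1, 28, 32, 44, 59, 70)` (case U); `(1, 28, 32, 54, 59, 60)` (case U); `(1, 28, 36, 40, 54, 75)` (case U); `(1, 28, 40, 45, 54, 66)` (case U); `(1, 28, 42, 45, 54, 64)` (case U); `(1, 30, 32, 42, 56, 73)` (case U); `(1,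 30, 41, 42, 53, 67)` (case U); `(1, 30, 41, 42, 56, 64)` (case U); `(1, 30, 42, 45, 53, 63)` (case U); `(1, 31, 32, 54, 56, 60)` (case U); `(1, 39, 42, 45, 53, 54)` (case U); `(1, 42, 43, 45, 49, 54)` (case U); `(2, 3, 14, 66, 72, 77)` (case N); `(2, 9, 28, 57, 63, 75)` (case N); `(2, 14, 18, 57, 66, 77)` (case N); `(2, 14, 33, 36, 72, 77)` (case N); `(2, 14, 36, 51, 54, 77)` (case N); `(2, 22, 28, 45, 63, 74)` (case N); `(2, 27, 28, 36, 66, 75)` (case N); `(2, 27, 28, 38, 64, 75)` (case N); `(2, 27, 28, 45, 66, 66)` (case N); `(2, 28, 30, 36, 63, 75)` (case N); `(2, 28, 30, 45, 63, 66)` (case N); `(3, 10, 18, 62, 69, 72)` (case N); `(3, 10, 24, 62, 63, 72)` (case N); `(3, 10, 32, 58, 62, 69)` (case N); `(3, 10, 45, 51, 62, 63)` (case N); `(3, 12, 42, 50, 51, 76)` (case N); `(3, 14, 24, 50, 66, 77)` (case N); `(3, 14, 33, 40, 72, 72)` (case N); `(3, 14, 40, 50, 51, 76)` (case N); `(3,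 14, 40, 51, 54, 72)` (case N); `(3, 15, 21, 50, 69, 76)` (case N); `(3, 15, 42, 48, 50, 76)` (case N); `(3, 21, 22, 45, 69, 74)` (case N); `(3, 21, 44, 45, 51, 70)` (case N); `(3, 24, 38, 42, 50, 77)` (case N); `(3, 30, 32, 42, 58, 69)` (case N); `(3, 32, 42, 42, 57, 58)` (case N); `(4, 9, 28, 60, 66, 67)` (case N); `(4, 9, 33, 56, 57, 75)` (case N); `(4, 9, 33, 56, 60, 72)` (case N); `(4, 9, 44, 51, 56, 70)` (case N); `(4, 9, 51, 54, 56, 60)` (case N); `(4, 15, 28, 54, 66, 67)` (case N); `(4, 15, 33, 50, 56, 76)` (case N); `(4, 15, 33, 54, 56, 72)` (case N); `(4, 15, 51, 54, 54, 56)` (case N); `(4, 28, 30, 51, 54, 67)` (case N); `(4, 30, 34, 51, 54, 61)` (case N); `(6, 6, 38, 45, 64, 75)` (case N); `(6, 9, 16, 60, 68, 75)` (case N); `(6, 12, 38, 50, 51, 77)` (case N); `(6, 14, 36, 50, 51, 77)` (case N); `(6, 15, 16, 54, 68, 75)` (case N); `(6, 15, 38, 48, 50, 77)` (case N); `(6,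 18, 22, 45, 69, 74)` (case N); `(6, 21, 38, 45, 60, 64)` (case N); `(6, 22, 24, 45, 63, 74)` (case N); `(6, 24, 27, 38, 64, 75)` (case N); `(6, 32, 38, 42, 45, 71)` (case N); `(6, 32, 38, 42, 57, 59)` (case N); `(6, 38, 42, 45, 50, 53)` (case N); `(8, 10, 34, 57, 62, 63)` (case N); `(8, 22, 27, 34, 69, 74)` (case N); `(8, 27, 30, 34, 66, 69)` (case N); `(8, 27, 33, 34, 57, 75)` (case N); `(8, 27, 34, 42, 57, 66)` (case N); `(8, 30, 30, 34, 63, 69)` (case N); `(8, 30, 34, 42, 57, 63)` (case N); `(9, 10, 24, 48, 70, 73)` (case N); `(9, 12, 44, 48, 51, 70)` (case N); `(9, 14, 40, 51, 57, 63)` (case N); `(9, 15, 44, 48, 48, 70)` (case N); `(9, 16, 20, 46, 68, 75)` (case N); `(9, 16, 21, 60, 60, 68)` (case N); `(9, 16, 24, 42, 70, 73)` (case N); `(9, 16, 34, 42, 60, 73)` (case N); `(9, 20, 36, 46, 48, 75)` (case N); `(9, 20, 45, 46, 48, 66)` (case N); `(9, 20, 45, 46, 51, 63)` (case N); `(10,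 12, 18, 51, 70, 73)` (case N); `(10, 15, 18, 48, 70, 73)` (case N); `(10, 18, 18, 57, 62, 69)` (case N); `(10, 18, 24, 57, 62, 63)` (case N); `(10, 21, 24, 36, 70, 73)` (case N); `(12, 12, 33, 50, 51, 76)` (case N); `(12, 15, 33, 48, 50, 76)` (case N); `(12, 21, 32, 38, 60, 71)` (case N); `(12, 21, 36, 44, 51, 70)` (case N); `(12, 24, 33, 38, 50, 77)` (case N); `(12, 30, 32, 33, 58, 69)` (case N); `(12, 32, 33, 42, 57, 58)` (case N); `(14, 18, 20, 45, 66, 71)` (case N); `(14, 18, 33, 40, 57, 72)` (case N); `(14, 18, 40, 51, 54, 57)` (case N); `(14, 20, 36, 51, 54, 59)` (case N); `(14, 24, 33, 36, 50, 77)` (case N); `(14, 32, 33, 40, 57, 58)` (case N); `(15, 16, 18, 42, 70, 73)` (case N); `(15, 16, 21, 44, 68, 70)` (case N); `(15, 16, 21, 54, 60, 68)` (case N); `(15, 16, 27, 33, 68, 75)` (case N); `(15, 16, 34, 42, 54, 73)` (case N); `(15, 21, 27, 38, 64, 69)` (case N); `(15, 21, 36, 44, 48, 70)` (case N); `(15,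 27, 32, 33, 58, 69)` (case N); `(16, 21, 24, 30, 70, 73)` (case N); `(16, 21, 30, 34, 60, 73)` (case N); `(18, 20, 38, 42, 45, 71)` (case N); `(18, 22, 24, 27, 69, 74)` (case N); `(20, 21, 36, 36, 46, 75)` (case N); `(20, 21, 36, 45, 46, 66)` (case N); `(20, 21, 38, 45, 46, 64)` (case N); `(21, 24, 27, 38, 60, 64)` (case N); `(22, 24, 24, 27, 63, 74)` (case N); `(24, 27, 32, 38, 42, 71)` (case N); `(24, 27, 38, 42, 50, 53)` (case N) — carry the table
certificate(s) written out in the statements below (generators checked by `genB`, the identity `s + ΣX = ΣY` by `decide`, all inside the kernel search).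

PRINT STATUS (lit seat, 2026-08-20). `78 = 2·3·13`: NO refereed theorem gives the Hodge conjecture for `X⁴₇₈` (as for `66`; `3 | 78`). In the tree the sibling cell reaches `78` by level raising from `39`; the cell's table settles `(78, 4)` by Lemma 3 cancellation (E3). This file: `(Q⁴₇₈)` as a kernel theorem ⇒ HC(X⁴₇₈) from Shioda's printed Claim alone.

References: [Shioda1979HodgeFermat] T. Shioda, Math. Ann. 245 (1979) 175–184, §3 p. 180 (`(Pⁿₘ)`), §4 pp. 183–184 (`M'ₘ`, `(Qⁿₘ)`, Claim,
the question); [Shioda1979PJA] T. Shioda, Proc. Japan Acad. 55A (1979) §1 (Definition (i)–(iii), `(Pⁿₘ)'`); [daSilva2021HodgeFermat]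
G. da Silva Jr., Experimental Results 2 (2021) e22, Def. 2.4, Question 1; [Aoki2000FermatTypeRemarks] N. Aoki, Comment. Math. Univ.
St. Pauli 49 (2000), Thm 0.1. Cell: `pub-hfermat-enum/P4-TABLE.md`, `data/shioda_Q4_m3-100.json`, `code/lit/q4/` (this seat).
-/

namespace Summit.HodgeConjecture.FermatCycles.ConditionQFourfold

open Multiset
open Literature.AlgebraicGeometry.HodgeTheory Literature.AlgebraicGeometry.HodgeTheory.FermatCharacter
open Literature.AlgebraicGeometry.Shioda1982 Literature.AlgebraicGeometry.Shioda1979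
open Summit.HodgeConjecture.FermatCycles.ShiodaConditionFourfold

/-! ### Level `78` — part A -/

/-! The certificate table at level `78` is the definition `table78` of `ConditionQFourfoldSeventyEightTable.lean` (156 entries `(key, X, Y)`,
`s + ΣX = ΣY`; found by `code/lit/q4/q4norm.py`, every entry checked by the kernel inside the searches). -/

set_option maxHeartbeats 0 in
/-- The `(Q)`-search at level `78`, case U, first free representative in `[1, 16)` (68049 tuples). Kernel.
[cite: Shioda1979HodgeFermat, §4 condition (Qⁿₘ), p. 183] -/
theorem checkQU_78_1 :
    checkQU 78
      table78
      1 15 = true := by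
  decide +kernel

set_option maxHeartbeats 0 in
/-- The `(Q)`-search at level `78`, case U, first free representative in `[16, 31)` (68263 tuples). Kernel.
[cite: Shioda1979HodgeFermat, §4 condition (Qⁿₘ), p. 183] -/
theorem checkQU_78_16 :
    checkQU 78
      table78
      16 15 = true := by
  decide +kernel

end Summit.HodgeConjecture.FermatCycles.ConditionQFourfold
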